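import Mathlib
import HarnessLib
import Summits.ValiantsHypothesis.ValiantsHypothesis.Theses.MonotoneRestoration
import Literature.Computability.AlgebraicComplexity.ArithCircuit
import Literature.Computability.AlgebraicComplexity.ArithCircuitProofs
import Literature.Computability.AlgebraicComplexity.MonotoneStructure
import Literature.Computability.AlgebraicComplexity.PermanentIrreducible
import Literature.ModelTheory.FiniteModelTheory.CkEquiv
import Summits.ValiantsHypothesis.ValiantsHypothesis.Theorems.MonotoneRestorationMonotoneRestorationQPCosetCount
import Summits.ValiantsHypothesis.ValiantsHypothesis.Theorems.MonotoneRestorationMonotoneRestorationQPSymmetricLB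
import Summits.ValiantsHypothesis.ValiantsHypothesis.Theorems.MonotoneRestorationMonotoneRestorationQPSupportSymmetrisation
import Summits.ValiantsHypothesis.ValiantsHypothesis.Theorems.MonotoneRestorationMonotoneRestorationQPSparseRegime
import Summits.ValiantsHypothesis.ValiantsHypothesis.Theorems.MonotoneRestorationMonotoneRestorationQPBeta
import Literature.Computability.AlgebraicComplexity.SymmetricArithCircuit
import Literature.Computability.AlgebraicComplexity.DawarWilsenach2025Proofs
import Literature.GroupTheory.PermutationGroups.SmallIndexSubgroups
import Summits.ValiantsHypothesis.ValiantsHypothesis.Theorems.MonotoneRestorationQP.Negative.LoadBearing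
import Summits.ValiantsHypothesis.ValiantsHypothesis.Theorems.MonotoneRestorationMonotoneRestorationQPPermSupportCount

/-! TTRL-lite variant V19021 of stmt-ValiantsHypothesis-15886 -/

set_option linter.dupNamespace false

namespace Summit.ValiantsHypothesis.ValiantsHypothesis.Theorems

open Summit.ValiantsHypothesis.ValiantsHypothesis.Theses.MonotoneRestoration
open Literature.Computability.AlgebraicComplexity

/-- TTRL-lite variant V19021 (`σ := Fin 0`, no variables) of `stub_monotoneComputation_of_complexity`
(stmt-ValiantsHypothesis-15886): a polynomial in no variables over `ℝ≥0` is a constant `C c`, and the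
gate-free circuit `ArithCircuit.ofConst c` is a Jerrum–Snir monotone computation of it of size `0`
(`isMonotoneComputation_ofConst`: constants are free inputs), so the bound `0 ≤ 3 · complexity f`
is trivial. [cite: JerrumSnir1982, §2.2] -/
theorem stub_monotoneComputation_of_complexity_var19021 :
    ∀ (f : MvPolynomial (Fin 0) NNReal), ∃ P : ArithCircuit NNReal (Fin 0),
      Literature.Barriers.ValiantsHypothesis.IsMonotoneComputation P f ∧ P.size ≤ 3 * complexity f := by
  intro f
  obtain ⟨c, rfl⟩ : ∃ c : NNReal, f = MvPolynomial.C c := ⟨_, MvPolynomial.eq_C_of_isEmpty f⟩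
  exact ⟨ArithCircuit.ofConst c,
    (Literature.Barriers.ValiantsHypothesis.isMonotoneComputation_ofConst c).1,
    (Literature.Barriers.ValiantsHypothesis.isMonotoneComputation_ofConst c).2.trans_le (Nat.zero_le _)⟩

end Summit.ValiantsHypothesis.ValiantsHypothesis.Theorems
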